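import Summits.AnomalousDissipation.AnomalousDissipation.Theses.LandauJetArena

/-!
# Line `seam` for crux `LandauJetArena.JetPairZerothLaw` (stmt-AnomalousDissipation-1540) — crux-strategist, 2026-08-17

REGISTERED SKELETON of the strategist's DECOMPOSITION (BC2 redirect): the crux `X = JetPairZerothLaw`
(zeroth law restricted to push–pull jet-pair forces; `closes : X → AnomalousDissipation` is a 3-line repack,
so X alone is summit-strength) is concluded BY NAME from two stubs that are the two CHILDREN of the split
(`route edit --split JetPairZerothLaw --into children.json`, children `JetPairWorkFloor`, `JetPairNoLeakFamily`):

* `stub_workFloor` — ∀-piece, INPUT-POWER FLOOR AT ZERO MOMENTUM (crux-sized; strictly weaker than the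
  route's rank-2 crux `JetPairDissipationFloor`, see `SeamByName.jetPairWorkFloor_of_dissipationFloor`);
* `stub_noLeakFamily` — ∃-piece, BOUNDED ZERO-MOMENTUM NO-LEAK FAMILY (crux-sized; no stronger than the
  zero-momentum crux, see `SeamByName.jetPairNoLeakFamily_of_zerothLawZM`; implies the route's r4).

`JetPairZerothLaw_of` is the glue, kernel-checked (no `sorry` outside the two stubs): reindex the family
past `ν₀(E)`, then `θ ε ≤ θ·power ≤ dissipation`. Per-piece birth skeletons (second layer, for the crux
chains on the children): `Lines/cascade-floor.lean` (∀-piece ⇐ forward-flux floor + low-mode balance +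
force tail) and `Lines/energy-equality-family.lean` (∃-piece ⇐ energy-equality bounded family + bookkeeping).
Probes (BC2(c)/BC3): `stub → X`, `stub → AnomalousDissipation` by `first | exact? | simpa | aesop` all FAIL
(folder bc/*_probe*.lean, rc 1, quoted in STRATEGY-CENSUS.md §4).
-/

namespace Summit.AnomalousDissipation.AnomalousDissipation.Cruxes.JetPairZerothLaw.SeamLine

set_option linter.dupNamespace false

open Filter Topology MeasureTheory
open Summit.AnomalousDissipation.AnomalousDissipation.Theses.LandauJetArena (JetPairZerothLaw)

/-- **stub (∀-piece = child `JetPairWorkFloor`): input-power floor at zero momentum.** -/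
theorem stub_workFloor :
    ∀ (ρ : ℝ) (a : UnitAddTorus (Fin 3)) (φ : UnitAddTorus (Fin 3) → ℝ) (f : UnitAddTorus (Fin 3) → EuclideanSpace ℝ (Fin 3)), (0 < ρ ∧ 4 * ρ < ‖a + a‖ ∧ Literature.Analysis.FunctionSpaces.Torus.IsSmooth φ ∧ (∀ x, 0 ≤ φ x) ∧ (∀ x : UnitAddTorus (Fin 3), ρ ≤ ‖x‖ → φ x = 0) ∧ MeasureTheory.integral MeasureTheory.volume (fun x => φ x) = 1 ∧ Literature.Analysis.FunctionSpaces.Torus.IsSmooth f ∧ Literature.Analysis.FunctionSpaces.Torus.IsDivFree f ∧ Literature.Analysis.FunctionSpaces.Torus.HasZeroMean f ∧ (∀ w : UnitAddTorus (Fin 3) → EuclideanSpace ℝ (Fin 3), Literature.Analysis.FunctionSpaces.Torus.IsSmooth w → Literature.Analysis.FunctionSpaces.Torus.IsDivFree w → MeasureTheory.integral MeasureTheory.volume (fun x => inner ℝ (f x) (w x)) = MeasureTheory.integral MeasureTheory.volume (fun x => (φ (x - a) - φ (x + a)) * inner ℝ (w x) (EuclideanSpace.single (2 : Fin 3) (1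 : ℝ) : EuclideanSpace ℝ (Fin 3))))) → ∀ E : ℝ, ∃ ε : ℝ, 0 < ε ∧ ∃ ν₀ : ℝ, 0 < ν₀ ∧ ∀ (ν : ℝ) (u₀ : UnitAddTorus (Fin 3) → EuclideanSpace ℝ (Fin 3)) (u : ℝ → UnitAddTorus (Fin 3) → EuclideanSpace ℝ (Fin 3)), 0 < ν → ν ≤ ν₀ → Literature.Analysis.FunctionSpaces.Torus.HasZeroMean u₀ → Literature.Analysis.FluidPDE.Torus.IsGlobalLerayHopf ν (fun _ => f) u₀ u → Literature.Analysis.FluidPDE.meanEnergy u ≤ E → ε ≤ Literature.Analysis.FluidPDE.longTimeAvgSup (fun t => MeasureTheory.integral MeasureTheory.volume (fun x => inner ℝ (f x) (u t x))) := by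
  sorry

/-- **stub (∃-piece = child `JetPairNoLeakFamily`): bounded zero-momentum no-leak family.** -/
theorem stub_noLeakFamily :
    ∃ (ρ : ℝ) (a : UnitAddTorus (Fin 3)) (φ : UnitAddTorus (Fin 3) → ℝ) (f : UnitAddTorus (Fin 3) → EuclideanSpace ℝ (Fin 3)), (0 < ρ ∧ 4 * ρ < ‖a + a‖ ∧ Literature.Analysis.FunctionSpaces.Torus.IsSmooth φ ∧ (∀ x, 0 ≤ φ x) ∧ (∀ x : UnitAddTorus (Fin 3), ρ ≤ ‖x‖ → φ x = 0) ∧ MeasureTheory.integral MeasureTheory.volume (fun x => φ x) = 1 ∧ Literature.Analysis.FunctionSpaces.Torus.IsSmooth f ∧ Literature.Analysis.FunctionSpaces.Torus.IsDivFree f ∧ Literature.Analysis.FunctionSpaces.Torus.HasZeroMean f ∧ (∀ w : UnitAddTorus (Fin 3) → EuclideanSpace ℝ (Fin 3), Literature.Analysis.FunctionSpaces.Torus.IsSmooth w → Literature.Analysis.FunctionSpaces.Torus.IsDivFree w → MeasureTheory.integral MeasureTheory.volume (fun x => inner ℝ (f x) (w x)) = MeasureTheory.integral MeasureTheory.volume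 (fun x => (φ (x - a) - φ (x + a)) * inner ℝ (w x) (EuclideanSpace.single (2 : Fin 3) (1 : ℝ) : EuclideanSpace ℝ (Fin 3))))) ∧ ∃ (E θ : ℝ) (ν : ℕ → ℝ) (u₀ : ℕ → UnitAddTorus (Fin 3) → EuclideanSpace ℝ (Fin 3)) (u : ℕ → ℝ → UnitAddTorus (Fin 3) → EuclideanSpace ℝ (Fin 3)), 0 < θ ∧ (∀ j, 0 < ν j) ∧ Filter.Tendsto ν Filter.atTop (nhds 0) ∧ (∀ j, Literature.Analysis.FunctionSpaces.Torus.HasZeroMean (u₀ j)) ∧ (∀ j, Literature.Analysis.FluidPDE.Torus.IsGlobalLerayHopf (ν j) (fun _ => f) (u₀ j) (u j)) ∧ (∀ j, Literature.Analysis.FluidPDE.meanEnergy (u j) ≤ E) ∧ ∀ j, θ * Literature.Analysis.FluidPDE.longTimeAvgSup (fun t => MeasureTheory.integral MeasureTheory.volume (fun x => inner ℝ (f x) (u j t x))) ≤ Literature.Analysis.FluidPDE.meanDissipation (ν j) (u j) := by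
  sorry

/-- **The glue, concluding the crux BY NAME from the two registered stubs** (kernel-checked; the only
`sorry`s are inside `stub_workFloor`, `stub_noLeakFamily`): take the configuration, `E`, `θ` and the family
from `stub_noLeakFamily`; `stub_workFloor` there gives `ε, ν₀ > 0`; reindex the family past `ν₀`
(`Tendsto ν atTop (𝓝 0)`), then `θ ε ≤ θ · power ≤ dissipation`. The parametric form
(`WorkFloor → NoLeakFamily → JetPairZerothLaw`) is `Split.lean` / `SeamByName.lean`. -/
theorem JetPairZerothLaw_of : JetPairZerothLaw := by
  obtain ⟨ρ, a, φ, f, hcfg, E, θ, ν, u₀, u, hθ, hν, hT, hzm, hLH, hE, hNL⟩ := stub_noLeakFamily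
  obtain ⟨ε, hε, ν₀, hν₀, hfl⟩ := stub_workFloor ρ a φ f hcfg E
  obtain ⟨J, hJ⟩ := eventually_atTop.1 (hT.eventually (Iic_mem_nhds hν₀))
  refine ⟨ρ, a, φ, f, hcfg, fun j => ν (j + J), fun j => u₀ (j + J), fun j => u (j + J),
    fun j => hν (j + J), hT.comp (tendsto_add_atTop_nat J), fun j => hLH (j + J),
    ⟨E, fun j => hE (j + J)⟩, θ * ε, mul_pos hθ hε, fun j => ?_⟩
  have hw : ε ≤ Literature.Analysis.FluidPDE.longTimeAvgSup
      (fun t => MeasureTheory.integral MeasureTheory.volume (fun x => inner ℝ (f x) (u (j + J) t x))) :=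
    hfl (ν (j + J)) (u₀ (j + J)) (u (j + J)) (hν (j + J)) (hJ (j + J) (Nat.le_add_left J j))
      (hzm (j + J)) (hLH (j + J)) (hE (j + J))
  calc θ * ε ≤ θ * Literature.Analysis.FluidPDE.longTimeAvgSup
        (fun t => MeasureTheory.integral MeasureTheory.volume (fun x => inner ℝ (f x) (u (j + J) t x))) :=
        mul_le_mul_of_nonneg_left hw hθ.le
    _ ≤ Literature.Analysis.FluidPDE.meanDissipation (ν (j + J)) (u (j + J)) := hNL (j + J)

end Summit.AnomalousDissipation.AnomalousDissipation.Cruxes.JetPairZerothLaw.SeamLine
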